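import Summits.HubbardSuperconductivity.HubbardSuperconductivity.Theorems.AnisotropyChordTransferFibre3FinX3Eval
import Summits.HubbardSuperconductivity.HubbardSuperconductivity.Theorems.AnisotropyChordTransferFibre3FinXDCover

/-!
# Route `AnisotropyChord` / H0 rotor rung: FIN per-`L` GM₃ (X3, `L ≥ 25`) — the row-D cell with `nt` given is sound

Soundness of `…FinX3Eval.xdCellOKN` / `xdCellAnyN0`: the X3 row-D cell data `xdCN L la lb nt` is g7's `xdC L la lb` with the field
`nt` replaced by the INPUT bracket (★ `xdCN_eq`), so every enclosure lemma of g7's chain (`mem_denMain`, `mem_psi`, `cmem_ftwBd`,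
`mem_scalars`) transfers definitionally; given `T⁺ − 3λ₂ ∈ nt` (exported by the combined X3 cell of the same λ-cell, `…FinX3SoundC`)
the box of `R̂′(k)` (★ `cmem_rhatN`) and g7's summation argument give ★★ `xd_cell_sound_ofN` / `xd_cell_soundN`:
`lowG ≤ aD·η_eff·U` for every ground two-magnon profile of the cell (`9 ≤ L`, `0 ≤ Δ < 1`), and the cover form ★ `xdN_cellAny_sound`.
Prover seat `hubbard-h0-rotor-p3` g8; helper for piece A = stmt-HubbardSuperconductivity-23918 of rung 19089 (`--supports`, helper
class).  WHAT THIS IS NOT: nothing here proves superconductivity in the Hubbard model (rotor TARGET as worded stays FALSE, g15 verdict);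
ONE hypothesis (the KT-2a row, per `L`, per cell) of ONE conditional reduction.  Tree imports only; no sorry, no new axioms.
-/

set_option linter.dupNamespace false
set_option autoImplicit false

namespace Summit.HubbardSuperconductivity.HubbardSuperconductivity.Theorems.AnisotropyChord.Transfer.Fibre3

namespace FinXD

open scoped BigOperators
open Finset Hole2 FinCell FinXB RowD L2.N1

/-- the X3 row-D cell data with the point tables recomputed. -/
def xdCN (L : ℕ) (la lb : ℤ) (nt : Iv) : XDCell := xdCellN L la lb nt (xdPoint L la) (xdPoint L lb)

/-- ★ `xdCN` is g7's `xdC` with the `nt` field replaced. [folklore] -/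
theorem xdCN_eq (L : ℕ) (la lb : ℤ) (nt : Iv) : xdCN L la lb nt = { xdC L la lb with nt := nt } := rfl

section cell

variable {L : ℕ} [NeZero L] {Δ lam2 : ℝ} {f : Tor L → ℝ} {la lb : ℤ} (H : XDHyp (L := L) Δ lam2 f la lb)
include H

/-- ★ the box of `R̂′(k)` with `nt` given: `den·Ψ̂¹ − Δ·FTW + Bd ∈ (C.rhat k).1` and `den ≥ (C.rhat k).2 / D`. [folklore] -/
theorem cmem_rhatN {nt : Iv} (hnt : mem (Tplus L Δ f - 3 * lam2) nt) {k : (ℤ × ℤ) × (ℤ × ℤ)} (hk : k ∈ xdLow) :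
    cmem (((den L (Tplus L Δ f) (B1.toTor L k.1) (B1.toTor L k.2) : ℝ) : ℂ) * PsiHat1 L f (B1.toTor L k.1) (B1.toTor L k.2)
        - (Δ : ℂ) * FTWfun L f (B1.toTor L k.1) (B1.toTor L k.2) + Bdfun L f (B1.toTor L k.1) (B1.toTor L k.2))
      ((xdCN L la lb nt).rhat k).1 ∧
    ((((xdCN L la lb nt).rhat k).2 : ℤ) : ℝ) ≤ den L (Tplus L Δ f) (B1.toTor L k.1) (B1.toTor L k.2) * ((D : ℤ) : ℝ) := by
  obtain ⟨-, ma, -, mfnn, -, -, -⟩ := mem_scalars H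
  have ma' : mem (Δ * f (K1 L)) (xdCN L la lb nt).a := ma
  have mfnn' : mem (f (K1 L)) (xdCN L la lb nt).fnn := mfnn
  have hdm : mem (epsT L (K1 L - B1.toTor L k.1 - B1.toTor L k.2) + epsT L (B1.toTor L k.1) + epsT L (B1.toTor L k.2)
      - eps1 L - 3 * lam2) ((xdCN L la lb nt).denMain k) := mem_denMain H k
  obtain ⟨ψ, eψ, mψ⟩ := mem_psi H hk
  have mψ' : mem ψ ((xdCN L la lb nt).psi k) := mψ
  obtain ⟨mF, mB⟩ := cmem_ftwBd H hk
  have mF' : cmem (ftwTerm L f (B1.toTor L k.1) (B1.toTor L k.2) (eDir L 0) + ftwTerm L f (B1.toTor L k.1) (B1.toTor L k.2) (eDir L 1)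
      + ftwTerm L f (B1.toTor L k.1) (B1.toTor L k.2) (eDir L 2) + ftwTerm L f (B1.toTor L k.1) (B1.toTor L k.2) (eDir L 3))
      ((xdCN L la lb nt).ftwBd k).1 := mF
  have mB' : cmem (bdTerm L f (B1.toTor L k.1) (B1.toTor L k.2) (eDir L 0) + bdTerm L f (B1.toTor L k.1) (B1.toTor L k.2) (eDir L 1)
      + bdTerm L f (B1.toTor L k.1) (B1.toTor L k.2) (eDir L 2) + bdTerm L f (B1.toTor L k.1) (B1.toTor L k.2) (eDir L 3))
      ((xdCN L la lb nt).ftwBd k).2 := mB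
  obtain ⟨eF, eB⟩ := ftw_bd_dirs (L := L) (f := f) (B1.toTor L k.1) (B1.toTor L k.2)
  have eden : den L (Tplus L Δ f) (B1.toTor L k.1) (B1.toTor L k.2)
      = (epsT L (K1 L - B1.toTor L k.1 - B1.toTor L k.2) + epsT L (B1.toTor L k.1) + epsT L (B1.toTor L k.2) - eps1 L - 3 * lam2)
        - (Tplus L Δ f - 3 * lam2) := by
    unfold den; ring
  have mden := mem_isub hdm hnt
  rw [← eden] at mden
  have hntC : (xdCN L la lb nt).nt = nt := rfl
  unfold XDCell.rhat
  rw [hntC]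
  constructor
  · set S1 := ftwTerm L f (B1.toTor L k.1) (B1.toTor L k.2) (eDir L 0) + ftwTerm L f (B1.toTor L k.1) (B1.toTor L k.2) (eDir L 1)
      + ftwTerm L f (B1.toTor L k.1) (B1.toTor L k.2) (eDir L 2) + ftwTerm L f (B1.toTor L k.1) (B1.toTor L k.2) (eDir L 3)
    set S2 := bdTerm L f (B1.toTor L k.1) (B1.toTor L k.2) (eDir L 0) + bdTerm L f (B1.toTor L k.1) (B1.toTor L k.2) (eDir L 1)
      + bdTerm L f (B1.toTor L k.1) (B1.toTor L k.2) (eDir L 2) + bdTerm L f (B1.toTor L k.1) (B1.toTor L k.2) (eDir L 3)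
    have e : ((den L (Tplus L Δ f) (B1.toTor L k.1) (B1.toTor L k.2) : ℝ) : ℂ) * PsiHat1 L f (B1.toTor L k.1) (B1.toTor L k.2)
        - (Δ : ℂ) * FTWfun L f (B1.toTor L k.1) (B1.toTor L k.2) + Bdfun L f (B1.toTor L k.1) (B1.toTor L k.2)
        = ((den L (Tplus L Δ f) (B1.toTor L k.1) (B1.toTor L k.2) * ψ : ℝ) : ℂ)
          + ((-(Δ * f (K1 L)) : ℝ) : ℂ) * S1 + ((f (K1 L) : ℝ) : ℂ) * S2 := by
      rw [eψ, eF, eB]; push_cast; ring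
    rw [e]
    exact cmem_cadd (cmem_cadd (cmem_cre (mem_imul mden mψ')) (cmem_cscal (mem_ineg ma') mF')) (cmem_cscal mfnn' mB')
  · obtain ⟨hlo, -⟩ := mden
    unfold isub at hlo
    simpa using hlo

/-- ★★ **THE X3 ROW-D CELL CERTIFICATE IS SOUND (core): `lowG ≤ aD·η_eff·U` for every ground profile of the cell**, given
`T⁺ − 3λ₂ ∈ nt`. -/
theorem xd_cell_sound_ofN {nt : Iv} (hnt : mem (Tplus L Δ f - 3 * lam2) nt) {aD : ℚ} (haD : 0 ≤ aD)
    (hs2 : ((xdCN L la lb nt).lowGSum).2 = true)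
    (htlo : 0 ≤ ((3 * la + nt.1 : ℤ) : ℚ) / ((D : ℤ) : ℚ))
    (hineq : ((xdCN L la lb nt).lowGSum).1 ≤ aD * ((((L : ℤ) * L : ℤ) : ℚ)) ^ 2 * (((((L : ℤ) * L : ℤ) : ℚ)) * (la : ℚ) / (4 * ((D : ℤ) : ℚ)))
      * (3 * ((((L : ℤ) * L : ℤ) : ℚ)) ^ 2 * (((3 * la + nt.1 : ℤ) : ℚ) / ((D : ℤ) : ℚ))) * ((D : ℤ) : ℚ)) :
    lowGForm L Δ f ≤ (aD : ℝ) * etaEff L lam2 * Uunit L Δ f := by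
  have hL8 : 8 ≤ L := by have := H.hL; omega
  have hD := D_pos
  have hV : (0 : ℝ) < (L : ℝ) ^ 2 := by
    have : (0 : ℝ) < L := by exact_mod_cast (show 0 < L by omega)
    positivity
  set C := xdCN L la lb nt with hCdef
  obtain ⟨hrow, hden⟩ := lowGRowForm_holds' L Δ lam2 f hL8 H.hf
  rw [hrow, sum_lowSet_eq L hL8, ← xdLow_eq, List.sum_toFinset _ (by rw [xdLow_eq]; exact lowList_nodup)]
  obtain ⟨hpos, hsum⟩ := lowGSum_spec C xdLow
  have hposk := hpos hs2
  set V4 : ℝ := ((L : ℝ) ^ 2) ^ 2 with hV4def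
  have hV4 : 0 < V4 := by positivity
  set qk : (ℤ × ℤ) × (ℤ × ℤ) → ℚ := fun k =>
    (((XDCell.amax (C.rhat k).1.1) ^ 2 + (XDCell.amax (C.rhat k).1.2) ^ 2 : ℤ) : ℚ) / (((C.rhat k).2 : ℤ) : ℚ) with hqk
  have hterm : ∀ k ∈ xdLow.toFinset,
      Complex.normSq (((den L (Tplus L Δ f) (B1.toTor L k.1) (B1.toTor L k.2) : ℝ) : ℂ) * PsiHat1 L f (B1.toTor L k.1) (B1.toTor L k.2)
          - (Δ : ℂ) * FTWfun L f (B1.toTor L k.1) (B1.toTor L k.2) + Bdfun L f (B1.toTor L k.1) (B1.toTor L k.2))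
        / (((L : ℝ) ^ 2) ^ 2 * den L (Tplus L Δ f) (B1.toTor L k.1) (B1.toTor L k.2))
      ≤ ((qk k : ℚ) : ℝ) / (((D : ℤ) : ℝ) * V4) := by
    intro k hk
    rw [List.mem_toFinset] at hk
    obtain ⟨hz, hdlo⟩ := cmem_rhatN H hnt hk
    have hn := normSq_le_of_cmem hz
    have hd0 : (0 : ℝ) < (((C.rhat k).2 : ℤ) : ℝ) := by exact_mod_cast hposk k hk
    have hdenpos : 0 < den L (Tplus L Δ f) (B1.toTor L k.1) (B1.toTor L k.2) := by nlinarith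
    set N : ℝ := (((XDCell.amax (C.rhat k).1.1) ^ 2 + (XDCell.amax (C.rhat k).1.2) ^ 2 : ℤ) : ℝ) with hN
    set dlo : ℝ := (((C.rhat k).2 : ℤ) : ℝ) with hdlo'
    set z := Complex.normSq (((den L (Tplus L Δ f) (B1.toTor L k.1) (B1.toTor L k.2) : ℝ) : ℂ) * PsiHat1 L f (B1.toTor L k.1) (B1.toTor L k.2)
          - (Δ : ℂ) * FTWfun L f (B1.toTor L k.1) (B1.toTor L k.2) + Bdfun L f (B1.toTor L k.1) (B1.toTor L k.2)) with hzdef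
    have hz0 : 0 ≤ z := Complex.normSq_nonneg _
    have hN0 : 0 ≤ N := by rw [hN]; positivity
    have h1 : z ≤ N / (((D : ℤ) : ℝ) * ((D : ℤ) : ℝ)) := by rw [le_div_iff₀ (by positivity)]; exact hn
    have h2 : dlo / ((D : ℤ) : ℝ) ≤ den L (Tplus L Δ f) (B1.toTor L k.1) (B1.toTor L k.2) := by
      rw [div_le_iff₀ hD]; exact hdlo
    have hq : ((qk k : ℚ) : ℝ) = N / dlo := by rw [hN, hdlo', hqk]; push_cast; ring
    rw [hq]
    calc z / (V4 * den L (Tplus L Δ f) (B1.toTor L k.1) (B1.toTor L k.2))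
        ≤ (N / (((D : ℤ) : ℝ) * ((D : ℤ) : ℝ))) / (V4 * (dlo / ((D : ℤ) : ℝ))) :=
          div_le_div₀ (by positivity) h1 (by positivity) (mul_le_mul_of_nonneg_left h2 hV4.le)
      _ = N / dlo / (((D : ℤ) : ℝ) * V4) := by
          field_simp
  have hS : (∑ pq ∈ xdLow.toFinset,
      Complex.normSq (((den L (Tplus L Δ f) (B1.toTor L pq.1) (B1.toTor L pq.2) : ℝ) : ℂ) * PsiHat1 L f (B1.toTor L pq.1) (B1.toTor L pq.2)
          - (Δ : ℂ) * FTWfun L f (B1.toTor L pq.1) (B1.toTor L pq.2) + Bdfun L f (B1.toTor L pq.1) (B1.toTor L pq.2))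
        / (((L : ℝ) ^ 2) ^ 2 * den L (Tplus L Δ f) (B1.toTor L pq.1) (B1.toTor L pq.2)))
      ≤ ((C.lowGSum.1 : ℚ) : ℝ) / (((D : ℤ) : ℝ) * V4) := by
    refine (Finset.sum_le_sum hterm).trans (le_of_eq ?_)
    rw [← Finset.sum_div]
    congr 1
    have e : C.lowGSum.1 = (xdLow.map qk).sum := by
      have := hsum
      exact this
    rw [e, ← List.sum_toFinset _ (by rw [xdLow_eq]; exact lowList_nodup)]
    push_cast
    rfl
  refine hS.trans ?_
  have hnt1 := hnt.1
  have hlam := H.hla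
  have hη : (((((L : ℤ) * L : ℤ) : ℚ)) * (la : ℚ) / (4 * ((D : ℤ) : ℚ)) : ℚ) ≤ etaEff L lam2 := by
    unfold etaEff
    push_cast
    rw [div_le_iff₀ (by positivity)]
    have e : ((L : ℝ) ^ 2) = (L : ℝ) * L := sq _
    nlinarith [hlam, hV]
  have hη0 : 0 ≤ etaEff L lam2 := by
    unfold etaEff
    have := lam2_pos L H.cellHyp.hL3 H.hΔ1 H.hf.1
    positivity
  have hT : ((((3 * la + nt.1 : ℤ) : ℚ) / ((D : ℤ) : ℚ) : ℚ) : ℝ) ≤ Tplus L Δ f := by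
    push_cast
    rw [div_le_iff₀ hD]
    nlinarith [hnt1, hlam]
  have hT0 : (0 : ℝ) ≤ ((((3 * la + nt.1 : ℤ) : ℚ) / ((D : ℤ) : ℚ) : ℚ) : ℝ) := by exact_mod_cast htlo
  have hU : 3 * V4 * (((((3 * la + nt.1 : ℤ) : ℚ) / ((D : ℤ) : ℚ) : ℚ) : ℝ)) ≤ Uunit L Δ f := by
    unfold Uunit; rw [hV4def]
    exact mul_le_mul_of_nonneg_left hT (by positivity)
  have hU0 : 0 ≤ 3 * V4 * (((((3 * la + nt.1 : ℤ) : ℚ) / ((D : ℤ) : ℚ) : ℚ) : ℝ)) := by positivity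
  have haD' : (0 : ℝ) ≤ (aD : ℝ) := by exact_mod_cast haD
  have hineqR := (Rat.cast_le (K := ℝ)).mpr hineq
  push_cast at hineqR hη hT hU hU0 hT0 ⊢
  rw [div_le_iff₀ (by positivity)]
  have eV : (((L : ℝ) * L) ^ 2) = V4 := by rw [hV4def]; ring
  rw [eV] at hineqR
  have hprod : ((L : ℝ) * L * la / (4 * ((D : ℤ) : ℝ))) * (3 * V4 * ((3 * (la : ℝ) + (nt.1 : ℝ)) / ((D : ℤ) : ℝ)))
      ≤ etaEff L lam2 * Uunit L Δ f :=
    (mul_le_mul_of_nonneg_right hη hU0).trans (mul_le_mul_of_nonneg_left hU hη0)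
  have hfin : (aD : ℝ) * V4 * (((L : ℝ) * L * la / (4 * ((D : ℤ) : ℝ))) * (3 * V4 * ((3 * (la : ℝ) + (nt.1 : ℝ)) / ((D : ℤ) : ℝ))))
      ≤ (aD : ℝ) * V4 * (etaEff L lam2 * Uunit L Δ f) := mul_le_mul_of_nonneg_left hprod (by positivity)
  nlinarith [hineqR, hfin, hD, hV4]

/-- ★★ **THE X3 ROW-D CELL CERTIFICATE IS SOUND**: `xdCellOKN L la lb aD nt (xdPoint L la) (xdPoint L lb) = true` and
`T⁺ − 3λ₂ ∈ nt` give `lowG ≤ aD·η_eff·U`. -/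
theorem xd_cell_sound_coreN {nt : Iv} (hnt : mem (Tplus L Δ f - 3 * lam2) nt) {aD : ℚ}
    (hcert : xdCellOKN L la lb aD nt (xdPoint L la) (xdPoint L lb) = true) :
    lowGForm L Δ f ≤ (aD : ℝ) * etaEff L lam2 * Uunit L Δ f := by
  unfold xdCellOKN at hcert
  simp only [Bool.and_eq_true, decide_eq_true_eq] at hcert
  obtain ⟨⟨⟨⟨⟨⟨⟨⟨-, -⟩, -⟩, -⟩, -⟩, hs2⟩, h0⟩, htlo⟩, hineq⟩ := hcert
  exact xd_cell_sound_ofN H hnt h0 hs2 htlo hineq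

end cell

/-- ★★ **THE X3 ROW-D CELL CERTIFICATE IS SOUND** (unbundled hypotheses; `9 ≤ L`, `0 ≤ Δ < 1`, `T⁺ − 3λ₂ ∈ nt`). -/
theorem xd_cell_soundN {L : ℕ} [NeZero L] (hL : 9 ≤ L) {Δ lam2 : ℝ} (hΔ0 : 0 ≤ Δ) (hΔ1 : Δ < 1) {f : Tor L → ℝ}
    (hf : IsGroundTwoMagnon L Δ lam2 f) {la lb : ℤ}
    (hla : (la : ℝ) ≤ lam2 * ((D : ℤ) : ℝ)) (hlb : lam2 * ((D : ℤ) : ℝ) ≤ (lb : ℝ)) {nt : Iv}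
    (hnt : mem (Tplus L Δ f - 3 * lam2) nt) {aD : ℚ}
    (hcert : xdCellOKN L la lb aD nt (xdPoint L la) (xdPoint L lb) = true) :
    lowGForm L Δ f ≤ (aD : ℝ) * etaEff L lam2 * Uunit L Δ f := by
  have h := hcert
  unfold xdCellOKN at h
  simp only [Bool.and_eq_true, decide_eq_true_eq] at h
  obtain ⟨⟨⟨⟨⟨⟨⟨⟨hchk, hsc⟩, hpos0⟩, hna⟩, -⟩, -⟩, -⟩, -⟩, -⟩ := h
  have H : XDHyp (L := L) Δ lam2 f la lb := ⟨hL, hΔ0, hΔ1, hf, hla, hlb, hchk, hsc, hpos0, hna⟩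
  exact xd_cell_sound_coreN H hnt hcert

/-- ★ one X3 row-D cell: for a ground profile at `0 < Δ ≤ Δ₁ < 1` with `λ₂·D` in a cell passing `xdCellAnyN0` and `T⁺ − 3λ₂ ∈ nt`,
`lowG ≤ aD·η_eff·U` (`9 ≤ L`). [folklore] -/
theorem xdN_cellAny_sound (L : ℕ) [NeZero L] (hL : 9 ≤ L) {d1 : ℚ} {Δ lam2 : ℝ} (hΔ0 : 0 < Δ) (hΔd : Δ ≤ (d1 : ℝ))
    (hΔ1 : Δ < 1) {f : Tor L → ℝ} (hf : IsGroundTwoMagnon L Δ lam2 f) {la lb : ℤ}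
    (hla : (la : ℝ) ≤ lam2 * ((D : ℤ) : ℝ)) (hlb : lam2 * ((D : ℤ) : ℝ) ≤ (lb : ℝ)) {aD : ℚ} {nt : Iv}
    (hnt : mem (Tplus L Δ f - 3 * lam2) nt)
    (hok : xdCellAnyN0 L d1 la lb aD nt = true) : lowGForm L Δ f ≤ (aD : ℝ) * etaEff L lam2 * Uunit L Δ f := by
  have hL3 : 3 ≤ L := by omega
  have hL5 : 5 ≤ L := by omega
  have hD := D_pos
  have hlam : 0 < lam2 := lam2_pos L hL3 hΔ1 hf.1
  have hΔe : Δ = deltaOfLam L lam2 := ground_delta_eq L hL5 hΔ0.le hΔ1 hf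
  unfold xdCellAnyN0 xdCellAnyTN at hok
  simp only [Bool.or_eq_true, Bool.and_eq_true, decide_eq_true_eq] at hok
  rcases hok with (⟨⟨hpos, hnum⟩, hG0⟩ | ⟨hgc, hvac⟩) | hcert
  · exact (vacuous_of_num_neg (L := L) hL3 hlam hla hlb hpos hnum hG0 hΔ0 hΔ1 hΔe).elim
  · exfalso
    have hmd := mem_delta_cell L hL3 hlam hla hlb hgc
    rw [← hΔe] at hmd
    obtain ⟨hlo, hhi⟩ := hmd
    rcases hvac with hneg | hbig
    · have : ((((deltaIv L la lb).2 : ℤ)) : ℝ) < 0 := by exact_mod_cast hneg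
      nlinarith
    · have hbig' : (d1 : ℝ) * ((D : ℤ) : ℝ) < ((((deltaIv L la lb).1 : ℤ)) : ℝ) := by
        have := hbig
        have e : (((D : ℚ)) : ℝ) = ((D : ℤ) : ℝ) := by norm_cast
        rw [← e]; exact_mod_cast this
      nlinarith
  · exact xd_cell_soundN hL hΔ0.le hΔ1 hf hla hlb hnt hcert

end FinXD

end Summit.HubbardSuperconductivity.HubbardSuperconductivity.Theorems.AnisotropyChord.Transfer.Fibre3
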